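import Literature.NumberTheory.PAdicHodge.KummerCocycleMatchingRational
import Literature.NumberTheory.EllipticCurves.PadicLogFiniteExtensionLocalFieldProofs
import Literature.NumberTheory.EllipticCurves.SelmerCorankProofs
import Literature.NumberTheory.EllipticCurves.PointDivisibilityProofs
import Literature.NumberTheory.GaloisRepresentations.LocalFieldFiniteExtension
import HarnessLib

/-!
# K1 for EVERY `ℚ_p`-rational point of a curve `W/ℤ` with good supersingular reduction at `p ≥ 5` (Bloch–Kato Example 3.11, `⊆`)

Topic `Literature/NumberTheory/PAdicHodge`; namespace `Literature.NumberTheory.PAdicHodge.AinfTop`. THEOREMS ONLY (no definition, no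
named fact, no instance, no `sorry`). Capstone of the K1 files `KummerCocycleMatching` / `KummerCocycleMatchingRational`: the last
bookkeeping hypotheses of ★★ `isFilZeroCoboundary_kummer_curveF_of_five_le_of_nsmul_of_zp` (a multiple `m • Q₀` in the kernel of
reduction with parameter in `pℤ_p`) are DISCHARGED for rational points, by the tree's index theorem
`FormalGroupChart.exists_nsmul_mem_level_of_isNonarchimedeanLocalField` (`E(F)/E⁽ᵖ⁾(F)` is torsion: AEC VII.2.1, VII.6.3, Ex. 7.6) and the
dictionary between `F`-rational points, geometric points and points over `ℂ_F`:

* `isIntegral_curveF` — `W ⊗ F` is `w`-integral for every valuation `w` of `F`;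
* `zCoord_geomToC_toGeomPoints`, `geomToC_toGeomPoints_mem_kernel` — `E(F) → E(F̄) → E(ℂ_F)` preserves the parameter `z = −x/y` and
  the kernel of reduction (for any valuation `w` compatible with the valuative structure of `F`: `|x|_w > 1 ⇒ ‖x‖_{ℂ_F} > 1`);
* ★★★ **`isFilZeroCoboundary_kummer_curveF_of_five_le_of_rational`** — `W/ℤ` with good supersingular reduction at `p ≥ 5`, `F` a `p`-adic
  field WITH `𝒪_F ⊆ ℤ_p` (i.e. `F = ℚ_p`: hypothesis `hOF`, every `w`-integer is in the image of `ℤ_p`), `P ∈ E(F)` ANY rational point,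
  `Q` ANY `p`-power division sequence of `P` in `E(F̄)`: the algebraic Kummer cocycle `σ ↦ 1 ⊗ (σQₙ − Qₙ)ₙ` is a `Fil⁰`-coboundary of
  `B_dR(F) ⊗ V_pE` — i.e. the `p`-adic Kummer class of every `ℚ_p`-rational point dies in `H¹(ℚ_p, B_dR⁺ ⊗ V_pE)` (Bloch–Kato Example 3.11:
  `κ(E(ℚ_p)) ⊗ ℚ ⊆ H¹_g = ker(H¹(ℚ_p, V) → H¹(ℚ_p, B_dR ⊗ V))`, here even into `B_dR⁺ ⊗ V`, at the cocycle level), UNCONDITIONALLY.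

Crux K★ `stmt-BirchSwinnertonDyer-22226`, hT₂/K3 programme brick K1 (the `⟸` half of (S5a) `PAdicHodge.expStarCoord_eq_zero_iff_kummer`
on `ℤ`-models at good supersingular `p ≥ 5`, for genuine Kummer classes). BSD / K★ are not proved by any of this.

## References
* [BlochKato1990] S. Bloch, K. Kato, *L-functions and Tamagawa numbers of motives* (1990), Ex. 3.10.1, Example 3.11 (3.11.1).
* [SilvermanAEC2009] J. H. Silverman, *AEC* (2009), Prop. VII.2.1–VII.2.2, VII.6 Cor. 6.2 / Ex. 7.6, VIII.§2.
* [Kato1993LNM1553] K. Kato, LNM 1553 (1993), Ch. II §1.2.4, Ex. 1.3.5.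
-/

noncomputable section

open scoped TensorProduct Classical NNReal

namespace Literature.NumberTheory.PAdicHodge

open Literature Literature.NumberTheory.GaloisRepresentations Literature.NumberTheory.EllipticCurves WeierstrassCurve
open Literature.NumberTheory.GaloisRepresentations.IsNonarchimedeanLocalField Field ValuativeRel
open Literature.NumberTheory.GaloisRepresentations.LubinTate Literature.NumberTheory.EllipticCurves.FormalGroupChart

namespace AinfTop

section RationalPoints

variable {F : Type} [Field F] [ValuativeRel F] [TopologicalSpace F] [IsNonarchimedeanLocalField F]
  (W : WeierstrassCurve ℤ) {p : ℕ}

omit [ValuativeRel F] [TopologicalSpace F] [IsNonarchimedeanLocalField F] in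
/-- **`W ⊗ F` is `w`-integral** for every valuation `w` of `F` (integers have `w ≤ 1`). [cite: SilvermanAEC2009, VII.§1] -/
theorem isIntegral_curveF (w : Valuation F ℝ≥0) : (curveF F W).IsIntegral w.integer :=
  WeierstrassCurve.isIntegral_of_exists_lift _ ⟨⟨_, intCast_mem w.integer W.a₁⟩, rfl⟩ ⟨⟨_, intCast_mem w.integer W.a₂⟩, rfl⟩
    ⟨⟨_, intCast_mem w.integer W.a₃⟩, rfl⟩ ⟨⟨_, intCast_mem w.integer W.a₄⟩, rfl⟩ ⟨⟨_, intCast_mem w.integer W.a₆⟩, rfl⟩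

omit [ValuativeRel F] [TopologicalSpace F] [IsNonarchimedeanLocalField F] in
/-- The geometric point of a rational affine point, with its coordinates. [cite: SilvermanAEC2009, VIII.§1] -/
theorem toGeomPoints_curveF_some {x y : F} (h : (curveF F W).toAffine.Nonsingular x y) :
    ∃ h', WeierstrassCurve.toGeomPoints (curveF F W) (.some x y h) =
      (.some (algebraMap F (AlgebraicClosure F) x) (algebraMap F (AlgebraicClosure F) y) h' : (curveF F W).geomPoints) :=
  ⟨(WeierstrassCurve.Affine.map_nonsingular _ (algebraMap F (AlgebraicClosure F)).injective x y).mpr h, rfl⟩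

/-- **`E(F) → E(F̄) → E(ℂ_F)` preserves the parameter**: `z(ι P) = ι z(P)`. [cite: SilvermanAEC2009, Prop. VII.2.2] -/
theorem zCoord_geomToC_toGeomPoints (P : (curveF F W).toAffine.Point) :
    (geomToC W (WeierstrassCurve.toGeomPoints (curveF F W) P)).zCoord = algebraMap F (CompletedAlgClosure F) P.zCoord := by
  rcases P with _ | ⟨x, y, h⟩
  · rw [← WeierstrassCurve.Affine.Point.zero_def, map_zero, map_zero, WeierstrassCurve.Affine.Point.zCoord_zero,
      WeierstrassCurve.Affine.Point.zCoord_zero, map_zero]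
  · obtain ⟨h₁, e₁⟩ := toGeomPoints_curveF_some W h
    obtain ⟨h₂, e₂⟩ := geomToC_some W h₁
    rw [e₁, e₂, WeierstrassCurve.Affine.Point.zCoord_some, WeierstrassCurve.Affine.Point.zCoord_some, algClosureToC_algebraMap,
      algClosureToC_algebraMap, map_div₀, map_neg]

/-- **`E(F) → E(F̄) → E(ℂ_F)` preserves the kernel of reduction** (for a valuation `w` of `F` compatible with its valuative structure:
`|x(P)|_w > 1 ⇒ ‖x(P)‖_{ℂ_F} > 1`, the embedding `F → ℂ_F` being isometric for the valuation norm). [cite: SilvermanAEC2009, Prop. VII.2.1–VII.2.2] -/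
theorem geomToC_toGeomPoints_mem_kernel (w : Valuation F ℝ≥0) [w.Compatible] [(curveF F W).IsIntegral w.integer]
    {P : (curveF F W).toAffine.Point}
    (hP : P ∈ kernel w (curveF F W)) :
    geomToC W (WeierstrassCurve.toGeomPoints (curveF F W) P) ∈
      kernel (NormedField.valuation (K := CompletedAlgClosure F)) (curveOver (CompletedAlgClosure F) W) := by
  rcases P with _ | ⟨x, y, h⟩
  · rw [← WeierstrassCurve.Affine.Point.zero_def, map_zero, map_zero]
    exact (kernel (NormedField.valuation (K := CompletedAlgClosure F)) (curveOver (CompletedAlgClosure F) W)).zero_mem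
  · obtain ⟨h₁, e₁⟩ := toGeomPoints_curveF_some W h
    obtain ⟨h₂, e₂⟩ := geomToC_some W h₁
    rw [e₁, e₂]
    refine (some_mem_kernel_iff h₂).mpr ?_
    rw [some_mem_kernel_iff h] at hP
    have hx : ¬ x ≤ᵥ (1 : F) := fun hle => by
      rw [Valuation.Compatible.vle_iff_le (v := w), map_one] at hle
      exact not_lt.2 hle hP
    have hn := (norm_lt_norm_iff_not_vle (K := F) 1 x).2 hx
    letI := nontriviallyNormedField F
    have h1 : ‖(1 : F)‖ = 1 := norm_one
    have hn' : (1 : ℝ) < ‖x‖ := by rw [← h1]; exact hn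
    change 1 < NormedField.valuation (K := CompletedAlgClosure F) (algClosureToC F (algebraMap F (AlgebraicClosure F) x))
    rw [algClosureToC_algebraMap, NormedField.valuation_apply, ← NNReal.coe_lt_coe, NNReal.coe_one, coe_nnnorm,
      CompletedAlgClosure.norm_algebraMap]
    exact hn'

/-- ★★★ **K1 for EVERY rational point over `ℚ_p` (good supersingular `W/ℤ`, `p ≥ 5`).** `F` a `p`-adic field whose `w`-integers come
from `ℤ_p` (`hOF`; i.e. `F = ℚ_p`), `P ∈ E(F)` any point, `Q` any `p`-power division sequence of `P` in `E(F̄)`. Then the algebraic Kummer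
cocycle `σ ↦ 1 ⊗ (σQₙ − Qₙ)ₙ` is a `Fil⁰`-coboundary of `B_dR(F) ⊗ V_pE`: the `p`-adic Kummer class of `P` dies in `H¹(F, B_dR⁺ ⊗ V_pE)`.
Proof: `m • P ∈ E⁽ᵖ⁾(F)` for some `m ≥ 1` (`exists_nsmul_mem_level_of_isNonarchimedeanLocalField`), so `z(m • P) = p·c` with `c ∈ ℤ_p`, and
★★ `isFilZeroCoboundary_kummer_curveF_of_five_le_of_nsmul_of_zp` applies through the dictionary `E(F) → E(F̄) → E(ℂ_F)`.
[cite: BlochKato1990, Ex. 3.10.1, Example 3.11 (3.11.1)] [cite: SilvermanAEC2009, Prop. VII.2.1–VII.2.2, VII.6 Cor. 6.2 and Ex. 7.6] -/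
theorem isFilZeroCoboundary_kummer_curveF_of_five_le_of_rational [CharZero F] [Fact p.Prime] [(curveF F W).IsElliptic]
    [(curveOver (CompletedAlgClosure F) W).IsElliptic]
    [Fact (¬ IsUnit (p : integerC F))] [IsAdicComplete (Ideal.span {(p : integerC F)}) (integerC F)]
    (hpF : valuation F p < 1) [Algebra ℚ_[p] F]
    (hp5 : 5 ≤ p) (hΔ : ¬ (p : ℤ) ∣ W.Δ) (hA : (W.map (Int.castRingHom (ZMod p))).hasseCoeff p = 0)
    (w : Valuation F ℝ≥0) [w.Compatible] (hOF : ∀ x : F, w x ≤ 1 → ∃ c : ℤ_[p], LocalField.padicRingHom F p hpF (c : ℚ_[p]) = x)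
    (P : (curveF F W).toAffine.Point) {Q : ℕ → (curveF F W).geomPoints} (hQ : ∀ n, p • Q (n + 1) = Q n)
    (hQ0 : Q 0 = WeierstrassCurve.toGeomPoints (curveF F W) P) (hfix : ∀ σ : absoluteGaloisGroup F, σ • Q 0 = Q 0) :
    (bdRPeriodRingData (F := F) (p := p) hpF).IsFilZeroCoboundary (rationalTateRep (curveF F W) p) fun σ =>
      ((1 : (bdRPeriodRingData (F := F) (p := p) hpF).B) ⊗ₜ[ℚ_[p]]
        TateModule.toRational p (TateModule.mk (fun n => σ • Q n - Q n) (pow_smul_kummer_eq_zero W hQ hfix σ)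
          (smul_kummer_succ W hQ σ)) :
        (bdRPeriodRingData (F := F) (p := p) hpF).B ⊗[ℚ_[p]] (curveF F W).rationalTateModule p) := by
  haveI := isIntegral_curveF (F := F) W w
  have hp0 : (p : F) ≠ 0 := Nat.cast_ne_zero.2 (Fact.out : p.Prime).ne_zero
  obtain ⟨m, hm, hlev⟩ := FormalGroupChart.exists_nsmul_mem_level_of_isNonarchimedeanLocalField (curveF F W) w hp0 P
  obtain ⟨hker, hz⟩ := FormalGroupChart.mem_level_iff.1 hlev
  have hwp : w (p : F) ≠ 0 := (Valuation.ne_zero_iff w).2 hp0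
  obtain ⟨c, hc⟩ := hOF ((m • P).zCoord / p) (by
    rw [map_div₀]
    exact div_le_one_of_le₀ hz zero_le)
  have hmQ : m • Q 0 = WeierstrassCurve.toGeomPoints (curveF F W) (m • P) := by rw [hQ0, map_nsmul]
  refine isFilZeroCoboundary_kummer_curveF_of_five_le_of_nsmul_of_zp W hpF hp5 hΔ hA hQ hfix hm.ne' ?_ c ?_
  · rw [hmQ]; exact geomToC_toGeomPoints_mem_kernel W w hker
  · rw [hmQ, zCoord_geomToC_toGeomPoints, PadicInt.coe_mul, PadicInt.coe_natCast, map_mul, map_natCast, hc,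
      mul_div_cancel₀ _ hp0]

omit [ValuativeRel F] [TopologicalSpace F] [IsNonarchimedeanLocalField F] in
/-- **Division sequences exist**: every point of `E(F̄)` has a `p`-power division sequence (`[p]` is onto `E(F̄)`, AEC III.4.2(a)).
[cite: SilvermanAEC2009, Prop. III.4.2(a) and VIII.§2] -/
theorem exists_divSeq [Fact p.Prime] [(curveF F W).IsElliptic] (P : (curveF F W).geomPoints) :
    ∃ Q : ℕ → (curveF F W).geomPoints, Q 0 = P ∧ ∀ n, p • Q (n + 1) = Q n := by
  have hsurj : ∀ R : (curveF F W).geomPoints, ∃ S : (curveF F W).geomPoints, p • S = R := fun R =>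
    ((curveF F W).baseChange (AlgebraicClosure F)).nsmul_surjective_of_isAlgClosed (Fact.out : p.Prime).ne_zero R
  choose f hf using hsurj
  exact ⟨fun n => Nat.rec P (fun _ R => f R) n, rfl, fun n => hf _⟩

omit [ValuativeRel F] [TopologicalSpace F] [IsNonarchimedeanLocalField F] in
/-- **The fixedness hypothesis of ★★★ is automatic** (recorded for consumers): `Q₀ = ι(P)` is `Γ_F`-fixed. [cite: SilvermanAEC2009, VIII.§1] -/
theorem smul_divSeq_zero_of_eq_toGeomPoints (P : (curveF F W).toAffine.Point) {Q : ℕ → (curveF F W).geomPoints}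
    (hQ0 : Q 0 = WeierstrassCurve.toGeomPoints (curveF F W) P) (σ : absoluteGaloisGroup F) : σ • Q 0 = Q 0 := by
  rw [hQ0]; exact WeierstrassCurve.smul_toGeomPoints _ σ P

end RationalPoints

end AinfTop

end Literature.NumberTheory.PAdicHodge

end
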